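import Mathlib
import Summits.MatrixMultiplication.MatrixMultiplication.Theses.SemilatticeSTPP

/-!
# Line `registered` of crux `SemilatticeSTPP.Thesis` (stmt-MatrixMultiplication-5969):
# the idempotent read-back — `IdempotentPacking ⇒ Thesis` and `IdempotentPacking ⇒ IdempotentVolumeBeat`

The route `SemilatticeSTPP` declares two dependency edges out of its rank-4 crux `IdempotentPacking`
(stmt-MatrixMultiplication-5972: for every `ε > 0` a finite commutative IDEMPOTENT monoid with a monoid-TPP
family, iff-form, and `|M| < Σᵢ (aᵢ bᵢ cᵢ)^((2+ε)/3)`):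

* `thesis_of_idempotentPacking` — edge `5972 ⇒ 5969`: `IdempotentPacking → Thesis`.  The thesis `X_M` asks for
  the same data in a finite commutative monoid with every element REGULAR (`∀ x, ∃ y, x * y * x = x`); an
  idempotent `x` is regular with witness `y := x` (`x * x * x = x * x = x`), and the family and the value are
  passed through unchanged.
* `idempotentVolumeBeat_of_idempotentPacking` — edge `5972 ⇒ 5970`: `IdempotentPacking → IdempotentVolumeBeat`.
  Specialise the packing to `ε := 1`: the exponent is `(2+1)/3 = 1`, `Real.rpow_one` turns the value into
  `Σᵢ ((aᵢ bᵢ cᵢ : ℕ) : ℝ) = ((Σᵢ aᵢ bᵢ cᵢ : ℕ) : ℝ)` (`Nat.cast_sum`), and `(|M| : ℝ) < (Σᵢ aᵢ bᵢ cᵢ : ℝ)` is the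
  natural-number inequality `|M| < Σᵢ aᵢ bᵢ cᵢ` (`Nat.cast_lt`), i.e. a semilattice host beating VOLUME.

Both were so far only proved in planner sketches; this file lands them against the route declarations
`…Theses.SemilatticeSTPP.IdempotentPacking / Thesis / IdempotentVolumeBeat` BY NAME (no new definitions).
Mathlib + the route file only; sorry-free.
-/

set_option linter.dupNamespace false
-- (single-conjunct summit: the namespace repeats `MatrixMultiplication`)

namespace Summit.MatrixMultiplication.MatrixMultiplication.Theorems.SemilatticeSTPPThesis

open Summit.MatrixMultiplication.MatrixMultiplication.Theses.SemilatticeSTPP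

/-- **Edge `IdempotentPacking ⇒ Thesis` (5972 ⇒ 5969).**  A finite commutative idempotent monoid is a Clifford
host: every element `x` is regular with witness `y := x`, since `x * x * x = x * x = x`; the monoid-TPP family
and the value inequality at exponent `(2+ε)/3` are unchanged. [folklore] -/
theorem thesis_of_idempotentPacking :
    Summit.MatrixMultiplication.MatrixMultiplication.Theses.SemilatticeSTPP.IdempotentPacking →
    Summit.MatrixMultiplication.MatrixMultiplication.Theses.SemilatticeSTPP.Thesis := by
  intro h ε hε
  obtain ⟨M, instM, instF, hid, p, a, b, c, α, β, γ, htpp, hcard⟩ := h ε hε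
  refine ⟨M, instM, instF, ?_, p, a, b, c, α, β, γ, htpp, hcard⟩
  intro x
  exact ⟨x, by rw [hid x, hid x]⟩

/-- **Edge `IdempotentPacking ⇒ IdempotentVolumeBeat` (5972 ⇒ 5970).**  At `ε := 1` the packing exponent is
`(2+1)/3 = 1`, so the value `Σᵢ ((aᵢ bᵢ cᵢ : ℕ) : ℝ) ^ 1 = ((Σᵢ aᵢ bᵢ cᵢ : ℕ) : ℝ)` (`Real.rpow_one`,
`Nat.cast_sum`), and `(|M| : ℝ) < ((Σᵢ aᵢ bᵢ cᵢ : ℕ) : ℝ)` is the natural-number inequality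
`|M| < Σᵢ aᵢ bᵢ cᵢ` (`Nat.cast_lt`): the same idempotent host and family beat volume. [folklore] -/
theorem idempotentVolumeBeat_of_idempotentPacking :
    Summit.MatrixMultiplication.MatrixMultiplication.Theses.SemilatticeSTPP.IdempotentPacking →
    Summit.MatrixMultiplication.MatrixMultiplication.Theses.SemilatticeSTPP.IdempotentVolumeBeat := by
  intro h
  obtain ⟨M, instM, instF, hid, p, a, b, c, α, β, γ, htpp, hcard⟩ := h 1 one_pos
  refine ⟨M, instM, instF, hid, p, a, b, c, α, β, γ, htpp, ?_⟩
  have hcast : ((Fintype.card M : ℕ) : ℝ) < ((∑ i, a i * b i * c i : ℕ) : ℝ) := by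
    rw [Nat.cast_sum]
    refine hcard.trans_eq (Finset.sum_congr rfl fun i _ => ?_)
    rw [show ((2 : ℝ) + 1) / 3 = 1 by norm_num, Real.rpow_one]
  exact_mod_cast hcast

end Summit.MatrixMultiplication.MatrixMultiplication.Theorems.SemilatticeSTPPThesis
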